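import Summits.BirchSwinnertonDyer.BirchSwinnertonDyer.Theorems.PrintCf2SplitBadTwoWeakLeopoldtAboveCyclotomicAtTwo
import Summits.BirchSwinnertonDyer.BirchSwinnertonDyer.Theorems.PrintCf2SplitBadTwoH2DivisibleAboveTower
import HarnessLib

/-!
# Greenberg's (T4) at `p = 2` for a TOTALLY COMPLEX base WITHOUT the `μ₄ ⊂ K′` clause
# (crux `SplitBadTwoRankOneOfFacts`, stmt-BirchSwinnertonDyer-20368; S3n′ lane by-product, S3a input)

Cell `bsd-print-cf2`, width seat `bsd-line-cf2-p1-w2` gen 12.  The printed source of the tree's (T4)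
(`Greenberg2006.weakLeopoldt_H2_subsingleton_above_cyclotomic_of_isOpen`, [NQD84] Thm. 2.2) assumes
`μ₄ ⊂ k` at `p = 2`; `…AboveCyclotomicAtTwo.weakLeopoldt_H2_subsingleton_above_cyclotomic_of_isOpen_two`
(this seat, p684911) keeps that binder (`U₀ ≤ ker χ̄₄`).  HERE THE BINDER IS REMOVED for a totally
complex `K`: for `S ⊇ {v ∣ 2}`, `κ : Fin m → ZpExtension K 2`, ANY open `U₀ ≥ N_S` with the
`χ₂`-torsion clause on `U₀ ∩ ⋂ᵢ ker κᵢ` (`K′K̃_∞ ⊇ K′^{cyc}`, `K′ = K̄^{U₀}`) and a discrete `D ≃+ ℚ₂/ℤ₂`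
with the trivial action over any inert `R`:  **`H²(Gal(K_Σ/K′K̃_∞), D) = 0`**.

Road: (1) above `K′(i)K̃_∞` the group vanishes (p684911, at `U₀ ∩ ker χ̄₄`); (2) `Gal(K_Σ/K′(i)K̃_∞)` is
an OPEN subgroup of the profinite `Gal(K_Σ/K′K̃_∞)` (image of `ker χ̄₄`), so by Serre I §2.4 Prop. 9
(`serre_prop9_ker_res_annihilated_by_index_holds`) `H²(Gal(K_Σ/K′K̃_∞), ℚ₂/ℤ₂)` is killed by the index;
(3) it is `2`-DIVISIBLE because `cd₂ Gal(K_Σ/K′K̃_∞) ≤ 2` (`K` totally complex; -w5 g4's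
`NoPseudoNullCut.subsingleton_H_of_groupCdLE_of_nsmul_eq_zero` / `groupCdLE_two_galoisGroupAbove`), hence
`0`; (4) the coefficient ring and the model of `ℚ₂/ℤ₂` are inert (`subsingleton_H2_trivial_of_ring`,
transport along `D ≃+ ℚ₂/ℤ₂`).

* **`weakLeopoldt_H2_subsingleton_above_cyclotomic_of_isOpen_two_tc`** — (T4)'s body at `p = 2` with
  `p ≠ 2` replaced by `IsTotallyComplex K`, nothing else.
* `weakLeopoldt_H2_subsingleton_above_tower_two_tc` — (A)'s body (`U₀ = ⊤`) at `p = 2`.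

Theorems only; no definition, no named fact, no `sorry`, no instance.  HONEST FRAMING: Iwasawa 1973 /
NSW (10.3.25) / [NQD84] Thm. 2.2 at `p = 2` for totally complex fields (NQD's `μ₄` clause is a
convenience of loc. cit., not of the theorem); closes nothing by itself (`--supports`).

References: [NguyenQuangDo1984] §0, Thm. 2.2; [Greenberg2006] pp. 343–344; [NeukirchSchmidtWingberg2008]
(8.3.18), (10.3.25); [SerreGaloisCohomology1997] I §2.4 Prop. 9, I §3.1 Prop. 11, I §3.3 Prop. 14.
-/

noncomputable section

open scoped Classical
open NumberField IsDedekindDomain Field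
open Literature.NumberTheory.GaloisRepresentations
open Literature.NumberTheory.EllipticCurves (ZpExtension)
open Literature.NumberTheory.IwasawaTheory Literature.NumberTheory.IwasawaTheory.Greenberg2006
open _root_.TopRep _root_.ContRepresentation _root_.ContinuousCohomology
open Summit.BirchSwinnertonDyer.BirchSwinnertonDyer.Theorems.PrintCf2.NoPseudoNullCut

set_option linter.dupNamespace false -- `Summit.BirchSwinnertonDyer.BirchSwinnertonDyer` (summit = problem) is the tree's layout

namespace Summit.BirchSwinnertonDyer.BirchSwinnertonDyer.Theorems.PrintCf2.WeakLeopoldtTwo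

variable {K : Type} [Field K] [NumberField K]

/-- **(T4) at `p = 2`, `K` totally complex, NO `μ₄` clause — model form**: the `ℤ₂`-linear trivial
representation on `ℚ₂/ℤ₂` of `Gal(K_Σ/K′K̃_∞) = galoisGroupAbove S (U₀ ⊓ ⋂ᵢ ker κᵢ)` has `H² = 0`
(`U₀ ≥ N_S` open with the `χ₂`-torsion clause).  Steps (1)–(3) of the module docstring.
[cite: NguyenQuangDo1984, Thm. 2.2] [cite: SerreGaloisCohomology1997, Ch. I §2.4 Prop. 9, §3.1 Prop. 11]
[cite: NeukirchSchmidtWingberg2008, (8.3.18), (10.3.25)] -/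
theorem subsingleton_H2_trivial_qpModZp_above_cyclotomic_two [IsTotallyComplex K]
    (S : Set (HeightOneSpectrum (𝓞 K)))
    (hS : ∀ v : HeightOneSpectrum (𝓞 K), ((2 : ℕ) : 𝓞 K) ∈ v.asIdeal → v ∈ S)
    {m : ℕ} (κ : Fin m → ZpExtension K 2) (U₀ : Subgroup (absoluteGaloisGroup K))
    (hU₀ : IsOpen (U₀ : Set (absoluteGaloisGroup K))) (hN : ramificationSubgroup K S ≤ U₀)
    (hcyc : ∀ σ : absoluteGaloisGroup K, σ ∈ U₀ ⊓ multiZpKer 2 κ →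
      GaloisRep.cyclotomicCharacter K 2 σ ∈ CommGroup.torsion ℤ_[2]ˣ)
    [DiscreteTopology (QpModZp 2)] [ContinuousSMul ℤ_[2] (QpModZp 2)] :
    Subsingleton ((ContinuousRep.trivial (galoisGroupAbove S (U₀ ⊓ multiZpKer 2 κ)) ℤ_[2]
      (QpModZp 2)).H 2) := by
  -- notation
  set Hsub : Subgroup (absoluteGaloisGroup K) := U₀ ⊓ multiZpKer 2 κ with hHsub
  set G₀ : Subgroup (GaloisGroupUnramifiedOutside K S) := galoisGroupAbove S Hsub with hG₀
  set F4 : Subgroup (absoluteGaloisGroup K) := (modNCyclotomicCharacter K (2 ^ 2)).ker with hF4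
  have hF4open : IsOpen (F4 : Set (absoluteGaloisGroup K)) := isOpen_ker_modNCyclotomicCharacter 2 2
  have hNF4 : ramificationSubgroup K S ≤ F4 := ramificationSubgroup_le_ker_modNCyclotomicCharacter 2 S hS 2
  have hHcl : IsClosed (Hsub : Set (absoluteGaloisGroup K)) :=
    (Subgroup.isClosed_of_isOpen U₀ hU₀).inter (isClosed_multiZpKer 2 κ)
  have hD : Nonempty (QpModZp 2 ≃+ ℚ_[2] ⧸ (PadicInt.subring 2).toAddSubgroup) :=
    ⟨QpModZp.addEquivQuotientSubring 2⟩
  -- (1) above `K′(i)K̃_∞`: vanishing at `U₀ ∩ ker χ̄₄`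
  have h1 : Subsingleton ((ContinuousRep.trivial (galoisGroupAbove S
      ((U₀ ⊓ F4) ⊓ multiZpKer 2 κ)) ℤ_[2] (QpModZp 2)).H 2) :=
    weakLeopoldt_H2_subsingleton_above_cyclotomic_of_isOpen_two K ‹IsTotallyComplex K› S hS κ
      (U₀ ⊓ F4) (hU₀.inter hF4open) (le_inf hN hNF4) inf_le_right
      (fun σ hσ ↦ hcyc σ (Subgroup.mem_inf.mpr
        ⟨(Subgroup.mem_inf.mp (Subgroup.mem_inf.mp hσ).1).1, (Subgroup.mem_inf.mp hσ).2⟩))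
      ℤ_[2] (QpModZp 2) hD
  -- (2) the open subgroup `H'' = Gal(K_Σ/K′(i)K̃_∞)` of `G₀`
  set H'' : Subgroup G₀ := (galoisGroupAbove S F4).subgroupOf G₀ with hH''
  have hGF : galoisGroupAbove S (F4 ⊓ Hsub) = galoisGroupAbove S F4 ⊓ G₀ :=
    galoisGroupAbove_inf_eq F4 Hsub hNF4
  have hlat : F4 ⊓ Hsub = (U₀ ⊓ F4) ⊓ multiZpKer 2 κ := by
    rw [hHsub, ← inf_assoc, inf_comm F4 U₀]
  have hU'eq : galoisGroupAbove S ((U₀ ⊓ F4) ⊓ multiZpKer 2 κ) = galoisGroupAbove S F4 ⊓ G₀ := by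
    rw [← hlat, hGF]
  have hH''eq : H'' = (galoisGroupAbove S F4 ⊓ G₀).subgroupOf G₀ := by
    ext u
    simp only [hH'', Subgroup.mem_subgroupOf, Subgroup.mem_inf, SetLike.coe_mem, and_true]
  let e₀ : H'' ≃* (galoisGroupAbove S ((U₀ ⊓ F4) ⊓ multiZpKer 2 κ)) :=
    ((MulEquiv.subgroupCongr hH''eq).trans (Subgroup.subgroupOfEquivOfLe inf_le_right)).trans
      (MulEquiv.subgroupCongr hU'eq.symm)
  have he₀ : ∀ u : H'', ((e₀ u : galoisGroupAbove S ((U₀ ⊓ F4) ⊓ multiZpKer 2 κ)) :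
      GaloisGroupUnramifiedOutside K S) = ((u : G₀) : GaloisGroupUnramifiedOutside K S) := fun _ ↦ rfl
  have he₀' : ∀ v : galoisGroupAbove S ((U₀ ⊓ F4) ⊓ multiZpKer 2 κ),
      (((e₀.symm v : H'') : G₀) : GaloisGroupUnramifiedOutside K S) =
        (v : GaloisGroupUnramifiedOutside K S) := fun _ ↦ rfl
  let e : H'' ≃ₜ* (galoisGroupAbove S ((U₀ ⊓ F4) ⊓ multiZpKer 2 κ)) :=
    { e₀ with
      continuous_toFun := by
        refine Topology.IsInducing.subtypeVal.continuous_iff.mpr ?_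
        show Continuous fun u : H'' ↦
          ((e₀ u : galoisGroupAbove S ((U₀ ⊓ F4) ⊓ multiZpKer 2 κ)) : GaloisGroupUnramifiedOutside K S)
        simp_rw [he₀]
        exact continuous_subtype_val.comp continuous_subtype_val
      continuous_invFun := by
        refine Topology.IsInducing.subtypeVal.continuous_iff.mpr
          (Topology.IsInducing.subtypeVal.continuous_iff.mpr ?_)
        show Continuous fun v : galoisGroupAbove S ((U₀ ⊓ F4) ⊓ multiZpKer 2 κ) ↦
          (((e₀.symm v : H'') : G₀) : GaloisGroupUnramifiedOutside K S)
        simp_rw [he₀']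
        exact continuous_subtype_val }
  have htrivH'' : Subsingleton ((ContinuousRep.trivial H'' ℤ_[2] (QpModZp 2)).H 2) := by
    haveI : Subsingleton (continuousCohomology 2
        (ContinuousRep.trivial (galoisGroupAbove S ((U₀ ⊓ F4) ⊓ multiZpKer 2 κ)) ℤ_[2]
          (QpModZp 2)).toTopRep) := h1
    exact subsingleton_continuousCohomology_of_continuousMulEquiv e
      (X := (ContinuousRep.trivial H'' ℤ_[2] (QpModZp 2)).toTopRep)
      (Y := (ContinuousRep.trivial (galoisGroupAbove S ((U₀ ⊓ F4) ⊓ multiZpKer 2 κ)) ℤ_[2]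
        (QpModZp 2)).toTopRep)
      (TopRep.ofHom ⟨ContinuousLinearMap.id ℤ_[2] (QpModZp 2), fun _ ↦ rfl⟩)
      (TopRep.ofHom ⟨ContinuousLinearMap.id ℤ_[2] (QpModZp 2), fun _ ↦ rfl⟩)
      (fun _ ↦ rfl) 2
  -- the restriction of the trivial representation to `H''` is the trivial representation
  set ρ : ContinuousRep G₀ ℤ_[2] (QpModZp 2) := ContinuousRep.trivial G₀ ℤ_[2] (QpModZp 2) with hρ
  have hrestr : ρ.restrict ⟨H''.subtype, continuous_subtype_val⟩ =
      ContinuousRep.trivial H'' ℤ_[2] (QpModZp 2) := by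
    refine ContinuousRep.ext fun u ↦ LinearMap.ext fun a ↦ ?_
    rfl
  -- Serre I §2.4 Prop. 9: `(G₀ : H'') • H² = 0`
  haveI : CompactSpace G₀ := compactSpace_galoisGroupAbove S Hsub hHcl
  haveI : TotallyDisconnectedSpace (GaloisGroupUnramifiedOutside K S) :=
    totallyDisconnectedSpace_galoisGroupUnramifiedOutside S
  have hH''open : IsOpen (H'' : Set G₀) :=
    (isOpen_galoisGroupAbove F4 hF4open).preimage continuous_subtype_val
  haveI hsub : Subsingleton ((ρ.restrict ⟨H''.subtype, continuous_subtype_val⟩).H 2) := by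
    rw [hrestr]; exact htrivH''
  have hkill : ∀ x : ρ.H 2, H''.index • x = 0 := fun x ↦
    serre_prop9_ker_res_annihilated_by_index_holds G₀ H'' hH''open ℤ_[2] (QpModZp 2) ρ 2 x
      (Subsingleton.elim _ _)
  -- (3) `cd₂ G₀ ≤ 2`: `H²` is divisible, hence zero
  exact subsingleton_H_of_groupCdLE_of_nsmul_eq_zero ρ (groupCdLE_two_galoisGroupAbove 2 S hS Hsub hHcl)
    (LinearEquiv.refl ℤ_[2] (QpModZp 2)) (index_ne_zero_of_isOpen H'' hH''open) hkill

/-- **(T4) at `p = 2` for `K` totally complex, NO `μ₄` clause** — the body of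
`Greenberg2006.weakLeopoldt_H2_subsingleton_above_cyclotomic_of_isOpen` at `p = 2` with `p ≠ 2` replaced
by `IsTotallyComplex K` and NOTHING else: weak Leopoldt `H²(Gal(K_Σ/K′K̃_∞), D) = 0` above every
`ℤ₂^m`-extension `K′K̃_∞ ⊇ K′^{cyc}` of every finite `K′ ⊆ K_Σ` over `K`, for every discrete `D ≃+ ℚ₂/ℤ₂`
with the trivial action over any inert coefficient ring.  From the model form by ring/model transport.
[cite: NguyenQuangDo1984, Thm. 2.2] [cite: Greenberg2006, pp. 343–344] [cite: NeukirchSchmidtWingberg2008, (10.3.25), (8.3.18)] -/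
theorem weakLeopoldt_H2_subsingleton_above_cyclotomic_of_isOpen_two_tc
    (K : Type) [Field K] [NumberField K] (hK : IsTotallyComplex K)
    (S : Set (HeightOneSpectrum (𝓞 K)))
    (hS : ∀ v : HeightOneSpectrum (𝓞 K), ((2 : ℕ) : 𝓞 K) ∈ v.asIdeal → v ∈ S)
    {m : ℕ} (κ : Fin m → ZpExtension K 2) (U₀ : Subgroup (absoluteGaloisGroup K))
    (hU₀ : IsOpen (U₀ : Set (absoluteGaloisGroup K))) (hN : ramificationSubgroup K S ≤ U₀)
    (hcyc : ∀ σ : absoluteGaloisGroup K, σ ∈ U₀ ⊓ multiZpKer 2 κ →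
      GaloisRep.cyclotomicCharacter K 2 σ ∈ CommGroup.torsion ℤ_[2]ˣ)
    (R : Type) [CommRing R] [TopologicalSpace R] [IsTopologicalRing R]
    (D : Type) [AddCommGroup D] [Module R D] [TopologicalSpace D] [DiscreteTopology D]
    [ContinuousSMul R D] (hD : Nonempty (D ≃+ ℚ_[2] ⧸ (PadicInt.subring 2).toAddSubgroup)) :
    Subsingleton ((ContinuousRep.trivial (galoisGroupAbove S (U₀ ⊓ multiZpKer 2 κ)) R D).H 2) := by
  haveI := hK
  haveI hQd : DiscreteTopology (QpModZp 2) := QpModZp.discreteTopology 2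
  haveI hQs : ContinuousSMul ℤ_[2] (QpModZp 2) := QpModZp.continuousSMul 2
  set Γ := galoisGroupAbove S (U₀ ⊓ multiZpKer 2 κ) with hΓ
  have hHcl : IsClosed ((U₀ ⊓ multiZpKer 2 κ : Subgroup (absoluteGaloisGroup K)) :
      Set (absoluteGaloisGroup K)) :=
    (Subgroup.isClosed_of_isOpen U₀ hU₀).inter (isClosed_multiZpKer 2 κ)
  haveI : CompactSpace Γ := compactSpace_galoisGroupAbove S _ hHcl
  -- the model: `ℤ₂`-linear trivial representation on `ℚ₂/ℤ₂`
  have h0 : Subsingleton ((ContinuousRep.trivial Γ ℤ_[2] (QpModZp 2)).H 2) :=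
    subsingleton_H2_trivial_qpModZp_above_cyclotomic_two S hS κ U₀ hU₀ hN hcyc
  -- ring change on the model: `ℤ₂ ↦ ℤ`
  have h0Z : Subsingleton (continuousCohomology 2 (ContinuousRep.trivial Γ ℤ (QpModZp 2)).toTopRep) :=
    subsingleton_H2_trivial_of_ring (R₁ := ℤ_[2]) h0
  -- model change along `D ≃+ ℚ₂/ℤ₂` (ℤ-linear, continuous between discrete spaces)
  obtain ⟨eD⟩ := hD
  let f : D ≃+ QpModZp 2 := eD.trans (QpModZp.addEquivQuotientSubring 2).symm
  have hDZ : Subsingleton (continuousCohomology 2 (ContinuousRep.trivial Γ ℤ D).toTopRep) := by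
    haveI := h0Z
    exact subsingleton_continuousCohomology_of_continuousMulEquiv (ContinuousMulEquiv.refl Γ)
      (X := (ContinuousRep.trivial Γ ℤ D).toTopRep)
      (Y := (ContinuousRep.trivial Γ ℤ (QpModZp 2)).toTopRep)
      (TopRep.ofHom ⟨⟨f.toAddMonoidHom.toIntLinearMap, continuous_of_discreteTopology⟩, fun _ ↦ rfl⟩)
      (TopRep.ofHom ⟨⟨f.symm.toAddMonoidHom.toIntLinearMap, continuous_of_discreteTopology⟩,
        fun _ ↦ rfl⟩)
      (fun x ↦ f.symm_apply_apply x) 2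
  -- ring change `ℤ ↦ R`
  exact subsingleton_H2_trivial_of_ring (R₁ := ℤ) hDZ

/-- **(A) at `p = 2` for `K` totally complex** (`U₀ = ⊤`): `H²(Gal(K_Σ/K̃_∞), D) = 0` above every
`ℤ₂^m`-extension `K̃_∞ ⊇ K^{cyc}` — in particular above the `ℤ₂²`-tower of an imaginary quadratic `K`
(`cyclotomicCharacter_mem_torsion_of_mem_multiZpKer`). [cite: Greenberg2006, pp. 343–344 (Hypothesis L)]
[cite: NguyenQuangDo1984, Thm. 2.2] -/
theorem weakLeopoldt_H2_subsingleton_above_tower_two_tc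
    (K : Type) [Field K] [NumberField K] (hK : IsTotallyComplex K)
    (S : Set (HeightOneSpectrum (𝓞 K)))
    (hS : ∀ v : HeightOneSpectrum (𝓞 K), ((2 : ℕ) : 𝓞 K) ∈ v.asIdeal → v ∈ S)
    {m : ℕ} (κ : Fin m → ZpExtension K 2)
    (hcyc : ∀ σ : absoluteGaloisGroup K, σ ∈ multiZpKer 2 κ →
      GaloisRep.cyclotomicCharacter K 2 σ ∈ CommGroup.torsion ℤ_[2]ˣ)
    (R : Type) [CommRing R] [TopologicalSpace R] [IsTopologicalRing R]
    (D : Type) [AddCommGroup D] [Module R D] [TopologicalSpace D] [DiscreteTopology D]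
    [ContinuousSMul R D] (hD : Nonempty (D ≃+ ℚ_[2] ⧸ (PadicInt.subring 2).toAddSubgroup)) :
    Subsingleton ((ContinuousRep.trivial (galoisGroupAbove S (multiZpKer 2 κ)) R D).H 2) := by
  have h := weakLeopoldt_H2_subsingleton_above_cyclotomic_of_isOpen_two_tc K hK S hS κ ⊤ isOpen_univ
    le_top (fun σ hσ ↦ hcyc σ (Subgroup.mem_inf.mp hσ).2) R D hD
  rwa [top_inf_eq] at h

end Summit.BirchSwinnertonDyer.BirchSwinnertonDyer.Theorems.PrintCf2.WeakLeopoldtTwo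

end
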